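import Summits.QuantumFields.YangMills.Theorems.BalabanUVNodesN26AtRecord13SepCoPH

/-!
# YangMills / Theorems / BalabanUVNodesK2StubD4FlatSlope — THE FLAT CORNER OF THE ROWS-(D4) ∧ B4 RESIDUE `Gaps.BetaContFromD4Chain.AtSlopeCont` IN CLOSED FORM,
# and what the REGISTERED (D4) stub of crux K2⁷ asserts at a colourless ∕ unit-block (D1) datum

Row-D4 OWNER desk (β-flow team (1), unit `b2b-balaban-beta-an4`, gen 148; BINDER-OWNERS row D4 «RemainderConst leaves for Bałaban's split»).
Supports-only ∕ count-neutral helper for crux K2⁷ `EndpointGivenBR13SepCoPH` = stmt-QuantumFields-20543 (plan g73's registered skeleton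
`K2Skeleton13SepCoPH.lean` sha16 6c3fc4f2e0bdd8aa: `stub_d1Residue13 : D1AtRecord13` (L), `stub_d4AtSlopeCont13 : D4AtSlopeOfD1Record13` (XL) — the
second is this row's located estimate at the Stage-13 record).  Companion of dag-n26's `YangMills/Theorems/BalabanUVNodesK2D1StubJetsFree` p505923 §2–§3 (`atSlopeCont_mono_slope`,
`exists_datum_of_oneLoopDrift_nonneg`, `registeredPair₁₃_iff_jetsFreePair`: the registered pair at θ ⟺ «`β⁰_θ` drifts with SOME slope `d ≥ 0` ∧
`AtSlopeCont (split₁₃ θ) γ₀ d`»), which leaves the branch `d = 0` un-evaluated.  Here it is evaluated.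

HONEST FRAMING (page 1 of everything this row writes): nothing of Bałaban's series is asserted or proved; (D4) INSTANCE 0∕1 for Bałaban's
split at every record; `stub_d4AtSlopeCont13` ∕ `stub_d1Residue13` ∕ K2⁷ NOT proved; N25 ∕ N26 NOT discharged; counts unmoved; one finite four-torus
programme at fixed ε per run — NOT the continuum limit, NOT ℝ⁴, NOT OS, NOT a mass gap, NOT Clay.  HONEST DEPENDENCY (cell, verbatim): «continuum
YM on T⁴ ⇐ BetaPertH ∧ nine spine estimates (0∕9 proved); BetaPertH ⇐ (D1) ∧ (D4) ∧ CAP+tail».  No `def`, no `instance`, no `notation`, no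
`axiom`, no `sorry`.

WHAT IS HERE ([folklore] algebra over the typed objects):
* §1 THE SLOPE OF `AtSlopeCont Sβ γ₀ s` (d = 4).  `abs_beta1_le_slope` (the residue at slope `s` bounds the boxed remainder: `|β¹_{k+1}(p)| ≤ s` on
  `]0, γ₀]^{k+1}` — `remainderConst_of_atSlopeCont` read pointwise); `slope_nonneg` (`0 < γ₀ ⟹ 0 ≤ s`: evaluate at the constant history `γ₀`);
  `beta1_eq_zero_of_slope_nonpos` (`s ≤ 0 ⟹ β¹ ≡ 0` on the boxes); and the converse **`atSlopeCont_zero_of_beta1_eq_zero`**: if `β¹ ≡ 0` on the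
  boxes then `AtSlopeCont Sβ γ₀ 0` HOLDS — witnessed by the FLAT CHAIN (remainder kernel `A¹ ≡ 0`, the zero leaves of `Beta.RemainderWitness`) at
  the DEGENERATE record `{c₀ 4 with ε₁ := 0}` (ℓ = 2, α₂ = 1, `q₀`, M = 1, channel (0,1)): every side condition of the residue (`CondsL`, the closing
  relation, `Consts190.Valid`, `SignsL`, (C-pt)) tolerates the activity constant `C₃ε₁ = 0`, so the seam inequality `ε₁·K_rem,L ≤ 0` is met with
  equality.  Hence **`atSlopeCont_zero_iff`**: `AtSlopeCont Sβ γ₀ 0 ⟺ ∀ k, ∀ p ∈ ]0, γ₀]^{k+1}, β¹_{k+1}(p) = 0` — AT SLOPE ZERO THE RESIDUE IS NOT AN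
  ESTIMATE BUT A RIGIDITY STATEMENT, and it is SATISFIABLE (not vacuous by typing).  For the definitional split of a merged β
  (`Node00.oneLoopSplit_betaOfMerged βm β0 γ`, the shape of every Stage-≥ 8 record): **`atSlopeCont_zero_split_iff`** — `AtSlopeCont … γ₀ 0 ⟺
  β_merged(p) = β⁰_{k+1}` for every history `p ∈ ]0, γ₀]^{k+1}` (`γ₀ ≤ γ`): the merged β-function is HISTORY-FREE on the box, equal to its own
  one-loop number.
* §2 AT THE REGISTERED STUB TEXT `D4AtSlopeOfD1Record13` (spelled VERBATIM, `N = 2`, `θ : Stage13HParams`, `Provisos₁₃SepCoPH`; the skeleton is not a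
  tree module).  A (D1) datum `(Lc, Js, Nc)` is FLAT when `stepBal Nc Lc = 0` — e.g. the colourless datum `Nc = 0` (`stepBal_zero_colour`) or the
  unit block `Lc = 1` (`stepBal_unit_block`; `log 1 = 0`); dag-n26's realisation `exists_datum_of_oneLoopDrift_nonneg` produces exactly such a datum
  from ANY bounded-partial-sum sequence (`d = 0`, `Nc = √0 = 0`).  **`historyFree_of_d4Stub_flatDatum`**: the registered stub ⟹ at every admissible
  θ with v1.7 provisos and every FLAT datum pinned on the record, the record's merged β IS history-free (`= β⁰_θ`) on some box family `]0, γ₀]^{k+1}`,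
  `0 < γ₀ ≤ θ.γ`; **`historyFree_of_d4Stub_boundedDrift`**: the same from «`β⁰_θ` has bounded partial sums» (`OneLoopDrift 0 A β⁰_θ`) alone.  READING
  FOR THE PLANNER (row-owner census; nothing here is a request): the `d = 0` branch of the registered ∕ jets-free pair is the statement «bounded
  one-loop partial sums ⟹ a history-free merged β near g = 0» — a statement print never makes ([I] (1.22) p. 264 with (2.13) p. 268: `β¹_{k+1}`
  VANISHES AT `g_k = 0`, it is not identically zero; p. 298: β_j «depends also on all preceding coupling constants»).  For Bałaban's record the branch
  is expected VACUOUS ((AF-0): `β⁰_{k+1} ≥ 2b > 0`, so no flat datum is pinned on it) — an (AF-0)-class fact, NODE O's, not a (D4)-class one; a cut of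
  K2 whose (D4) stub is a PURE ESTIMATE adds `0 < stepBal Nc Lc` (equivalently `0 < d`) to both stub texts, the composition `EndpointGivenBR13SepCoPH_of`
  being unchanged (it reads the slope only through `endpointExistence_of_residue_atSlopeCont`).
Sources (context only): [I] = [Balaban1987RG1] CMP **109** (1987): Thm 2 p. 259 (first sentence), (1.20)–(1.22) p. 264, (2.12)–(2.14) p. 268, p. 298;
[II] = [Balaban1988RG2Cluster] CMP **116** (1988): Lemma 3 (2.38) p. 20, p. 21 (after (2.39) ∕ (2.41)).
-/

noncomputable section

open scoped Matrix.Norms.L2Operator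

namespace Summit.QuantumFields.YangMills.Theorems.BalabanUVNodesK2StubD4FlatSlope

open Literature.MathematicalPhysics.QuantumFieldTheory.Balaban1983to89
open Literature.MathematicalPhysics.QuantumFieldTheory.Balaban1983to89.FlowStep
open Literature.MathematicalPhysics.QuantumFieldTheory.Balaban1983to89.T4Continuum (T4Family)
open Literature.MathematicalPhysics.QuantumFieldTheory.Balaban1983to89.Node00
open Literature.MathematicalPhysics.QuantumFieldTheory.Balaban1983to89.B13ScaleTransfer (Pt)
open Literature.MathematicalPhysics.QuantumFieldTheory.Balaban1983to89.Beta.OneStepKernelFamily (TbalOf)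
open Literature.MathematicalPhysics.QuantumFieldTheory.Balaban1983to89.Beta.OneStepResolventKernel (JetData)
open Literature.MathematicalPhysics.QuantumFieldTheory.Balaban1983to89.Beta.Drift (OneLoopDrift)
open Literature.MathematicalPhysics.QuantumFieldTheory.Balaban1983to89.Beta.RemainderChainLattice
open Literature.MathematicalPhysics.QuantumFieldTheory.Balaban1983to89.Beta.RemainderLimitTorus (LDom limKernel)
open Literature.MathematicalPhysics.QuantumFieldTheory.Balaban1983to89.Beta.RemainderDecay190
open Literature.MathematicalPhysics.QuantumFieldTheory.Balaban1983to89.Beta.RemainderDecay190HoloChain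
open Literature.MathematicalPhysics.QuantumFieldTheory.Balaban1983to89.Beta.RemainderWitness (c₀ q₀ q₀_valid c₀_R22gen zeroLeaves190)
open Summit.QuantumFields.BalabanUV.Gaps
open Summit.QuantumFields.BalabanUV.Gaps.BetaContFromD4Chain
open Summit.QuantumFields.YangMills.Theorems.BalabanUVNodesK2D1StubJetsFree (exists_datum_of_oneLoopDrift_nonneg)

/-! ## §1 The slope of `AtSlopeCont`: non-negative on a non-empty box family; the flat corner `s ≤ 0` in closed form -/

section Slope

variable {β : HBeta} {Sβ : B12Beta.OneLoopSplit β} {γ₀ s : ℝ}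

/-- The residue at slope `s` bounds the boxed remainder pointwise: `|β¹_{k+1}(p)| ≤ s` for `p ∈ ]0, γ₀]^{k+1}`
(`remainderConst_of_atSlopeCont`, i.e. [II] (2.38) + [I] (5.10) summed, read at one history). [cite: Balaban1988RG2Cluster, Lemma 3 (2.38) p.20; Balaban1987RG1, (1.22) p.264] -/
theorem abs_beta1_le_slope (h : AtSlopeCont Sβ γ₀ s) {k : ℕ} {p : Fin (k + 1) → ℝ} (hp : p ∈ B12Beta.HistBox γ₀ k) :
    |Sβ.β1 k p| ≤ s :=
  remainderConst_of_atSlopeCont h k p hp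

/-- On a non-empty box family (`0 < γ₀`) the slope of a residue is non-negative (evaluate at the constant history `γ₀` of length 1). [folklore] -/
theorem slope_nonneg (hγ₀ : 0 < γ₀) (h : AtSlopeCont Sβ γ₀ s) : 0 ≤ s :=
  (abs_nonneg _).trans (abs_beta1_le_slope h (k := 0) (p := fun _ => γ₀) fun _ => ⟨hγ₀, le_rfl⟩)

/-- No residue at a negative slope on a non-empty box family. [folklore] -/
theorem not_atSlopeCont_of_slope_neg (hγ₀ : 0 < γ₀) (hs : s < 0) : ¬ AtSlopeCont Sβ γ₀ s :=
  fun h => not_lt.mpr (slope_nonneg hγ₀ h) hs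

/-- At a non-positive slope the residue forces the boxed remainder to VANISH IDENTICALLY: `β¹_{k+1} ≡ 0` on `]0, γ₀]^{k+1}`, every `k`. [folklore] -/
theorem beta1_eq_zero_of_slope_nonpos (h : AtSlopeCont Sβ γ₀ s) (hs : s ≤ 0) {k : ℕ} {p : Fin (k + 1) → ℝ}
    (hp : p ∈ B12Beta.HistBox γ₀ k) : Sβ.β1 k p = 0 :=
  abs_nonpos_iff.mp ((abs_beta1_le_slope h hp).trans hs)

/-- **THE FLAT CHAIN AT A DEGENERATE RECORD** (generic form): if the boxed remainder vanishes identically, then for ANY [II]-record `c` with activity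
constant `ε₁ = 0` that meets `CondsL 4 c 2`, the closing relation at `ℓ = 2`, `q₀.Valid c.δ₀` and `0 < c.δ₀`, the chain with remainder kernel `A¹ ≡ 0`
and the zero leaves of `Beta.RemainderWitness` inhabits `ChainTFac190H 4 1 0 1 Sβ γ₀ c 2 1 q₀` with (C-pt), and the seam `ε₁·K_rem,L ≤ 0` holds with
equality: `AtSlopeCont Sβ γ₀ 0`. [folklore] -/
theorem atSlopeCont_zero_of_beta1_eq_zero_at (c : B13.Consts) (hε : c.ε₁ = 0) (hC : CondsL 4 c 2) (h22 : c.R22gen 2)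
    (hq : q₀.Valid c.δ₀) (hδ₀ : 0 < c.δ₀) (h0 : ∀ (k : ℕ) (p : Fin (k + 1) → ℝ), p ∈ B12Beta.HistBox γ₀ k → Sβ.β1 k p = 0) :
    AtSlopeCont Sβ γ₀ 0 := by
  have hA : 0 ≤ c.C3act * c.ε₁ := by rw [hε, mul_zero]
  have hsg : SignsL c 1 q₀.B₃ := hq.signsL hA one_pos hδ₀
  let R : ChainTFac190 4 1 (0 : Fin 4) 1 Sβ γ₀ c 2 1 q₀ :=
    { A1 := fun _ _ _ _ => 0
      beta1_eq := fun k p hp => by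
        rw [h0 k p hp]
        show (0 : ℝ) = B12Beta.secondMoment (fun _ _ => limKernel (fun (_ : LDom 4) (_ : Pt 4) => (0 : ℝ))) 0 1
        simp [B12Beta.secondMoment, limKernel]
      leaves := fun _ _ _ => zeroLeaves190 4 1 c 2 1 hA }
  refine ⟨1, inferInstance, 0, 1, c, 2, 1, q₀, ChainTFac190H.ofAnalytic R, ?_, hC, h22, hq, hsg, ?_⟩
  · intro k x
    show ContinuousOn (fun _ : Fin (k + 1) → ℝ => limKernel (fun (_ : LDom 4) (_ : Pt 4) => (0 : ℝ)) x) (Box γ₀ k)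
    exact continuousOn_const
  · rw [hε, zero_mul]

/-- **THE FLAT CORNER IS INHABITED**: `β¹ ≡ 0` on the boxes ⟹ `AtSlopeCont Sβ γ₀ 0`, at the degenerate record `{c₀ 4 with ε₁ := 0}` (the numeric
witness of `Beta.RemainderWitness` with its activity constant switched off: the four k-free conditions, the closing relation `(1 − 10δ)·2 = 1` and the
signs do not read `ε₁` except through `C₃ε₁ ≥ 0` ∕ `C₃ε₁ ≤ ε₁,thr`, both met by `0`). [cite: Balaban1988RG2Cluster, p.21 (after (2.39) and after (2.41))] -/
theorem atSlopeCont_zero_of_beta1_eq_zero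
    (h0 : ∀ (k : ℕ) (p : Fin (k + 1) → ℝ), p ∈ B12Beta.HistBox γ₀ k → Sβ.β1 k p = 0) : AtSlopeCont Sβ γ₀ 0 := by
  have hε : ({ c₀ 4 with ε₁ := 0 } : B13.Consts).ε₁ = 0 := rfl
  have h22 : ({ c₀ 4 with ε₁ := 0 } : B13.Consts).R22gen 2 := by
    show (1 - 10 * (1 / 20 : ℝ)) * 2 = 1
    norm_num
  have hδ₀ : (0 : ℝ) < ({ c₀ 4 with ε₁ := 0 } : B13.Consts).δ₀ := by
    show (0 : ℝ) < 1
    norm_num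
  have hq : q₀.Valid ({ c₀ 4 with ε₁ := 0 } : B13.Consts).δ₀ := q₀_valid
  refine atSlopeCont_zero_of_beta1_eq_zero_at { c₀ 4 with ε₁ := 0 } hε ?_ h22 hq hδ₀ h0
  refine CondsL.of_thresholds _ h22 (by norm_num) le_rfl le_rfl ?_
  rw [hε, mul_zero]
  exact (eps1ThresholdL_pos 4 _).le

/-- **`AtSlopeCont` AT SLOPE ZERO, IN CLOSED FORM**: `AtSlopeCont Sβ γ₀ 0 ⟺ β¹_{k+1} ≡ 0 on ]0, γ₀]^{k+1}` for every `k` — at a flat slope the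
rows-(D4) ∧ B4 residue is a RIGIDITY statement (identically vanishing remainder), not an estimate; and it is satisfiable. [folklore] -/
theorem atSlopeCont_zero_iff :
    AtSlopeCont Sβ γ₀ 0 ↔ ∀ (k : ℕ) (p : Fin (k + 1) → ℝ), p ∈ B12Beta.HistBox γ₀ k → Sβ.β1 k p = 0 :=
  ⟨fun h _ _ hp => beta1_eq_zero_of_slope_nonpos h le_rfl hp, atSlopeCont_zero_of_beta1_eq_zero⟩

/-- At a non-positive slope: `AtSlopeCont Sβ γ₀ s ⟹ AtSlopeCont Sβ γ₀ 0` (the remainder vanishes, so the flat chain serves). [folklore] -/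
theorem atSlopeCont_zero_of_slope_nonpos (h : AtSlopeCont Sβ γ₀ s) (hs : s ≤ 0) : AtSlopeCont Sβ γ₀ 0 :=
  atSlopeCont_zero_of_beta1_eq_zero fun _ _ hp => beta1_eq_zero_of_slope_nonpos h hs hp

end Slope

/-! ## §1b The flat corner for the definitional split of a merged β (`Node00.oneLoopSplit_betaOfMerged`) -/

section Merged

/-- The boxed remainder of the definitional split: `β¹_{k+1} = 𝟙_{]0,γ]^{k+1}}·(β_merged − β⁰_{k+1})` (by construction). [cite: Balaban1987RG1, (1.22) p.264 and (2.12)–(2.14) p.268 (bookkeeping)] -/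
theorem beta1_oneLoopSplit_betaOfMerged (βm : HBeta) (β0 : ℕ → ℝ) (γ : ℝ) (k : ℕ) (p : Fin (k + 1) → ℝ) :
    (oneLoopSplit_betaOfMerged βm β0 γ).β1 k p = (Box γ k).indicator (fun w => βm k w - β0 k) p := rfl

/-- **THE FLAT CORNER FOR A MERGED β**: on boxes `]0, γ₀]^{k+1}` with `γ₀ ≤ γ`, `AtSlopeCont (oneLoopSplit_betaOfMerged βm β0 γ) γ₀ 0 ⟺ β_merged(p) = β⁰_{k+1}`
for every history `p` in the box — the merged β-function is HISTORY-FREE there, equal to its one-loop number. [folklore] -/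
theorem atSlopeCont_zero_split_iff (βm : HBeta) (β0 : ℕ → ℝ) {γ γ₀ : ℝ} (hle : γ₀ ≤ γ) :
    AtSlopeCont (oneLoopSplit_betaOfMerged βm β0 γ) γ₀ 0 ↔
      ∀ (k : ℕ) (p : Fin (k + 1) → ℝ), p ∈ B12Beta.HistBox γ₀ k → βm k p = β0 k := by
  rw [atSlopeCont_zero_iff]
  refine forall_congr' fun k => forall_congr' fun p => forall_congr' fun hp => ?_
  have hmem : p ∈ Box γ k := mem_box.mpr fun i => ⟨(hp i).1, (hp i).2.trans hle⟩
  rw [beta1_oneLoopSplit_betaOfMerged, Set.indicator_of_mem hmem, sub_eq_zero]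

end Merged

/-! ## §2 At the REGISTERED (D4) stub text of K2⁷: flat (D1) data -/

section Stub

/-- The colourless datum is flat: `stepBal 0 L = 0`. [folklore] -/
theorem stepBal_zero_colour (L : ℝ) : B12Normalization.stepBal 0 L = 0 := by
  rw [B12Normalization.stepBal_eq]; ring

/-- The unit block is flat: `stepBal N 1 = 0` (`log 1 = 0`). [folklore] -/
theorem stepBal_unit_block (N : ℝ) : B12Normalization.stepBal N ((1 : ℕ) : ℝ) = 0 := by
  rw [B12Normalization.stepBal_eq, Nat.cast_one, Real.log_one, mul_zero]

/-- **THE REGISTERED (D4) STUB AT A FLAT DATUM ASSERTS A HISTORY-FREE MERGED β.**  `D4AtSlopeOfD1Record13` (plan g73's `K2Skeleton13SepCoPH`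
6c3fc4f2e0bdd8aa, stmt-QuantumFields-20543; text verbatim, `N = 2`) ⟹ at every admissible `θ : Stage13HParams F 2` with v1.7 provisos and every (D1) datum
`(Lc, Js, Nc)` pinned on the record with `stepBal Nc Lc = 0` (colourless `Nc = 0`, or unit block `Lc = 1`): on some box family `]0, γ₀]^{k+1}`, `0 < γ₀ ≤ θ.γ`,
the record's merged β-function EQUALS its one-loop number `β⁰_θ` at EVERY history (§1b).  A consequence of the stub's TEXT; the stub is NOT proved
(instance 0∕1). [cite: Balaban1987RG1, (1.20)–(1.22) p.264 and (2.12)–(2.14) p.268; Balaban1988RG2Cluster, Lemma 3 (2.38) p.20] -/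
theorem historyFree_of_d4Stub_flatDatum
    (h : ∀ (F : T4Family) (θ : Stage13HParams F 2) (hP : θ.Provisos₁₃SepCoPH F 2), θ.Admissible F 2 →
      letI := θ.instVβ₁; letI := θ.instVβ₂; letI := θ.instιβ
      ∀ (Lc : ℕ) (_ : NeZero Lc) (Js : ℕ → JetData 3 Lc) (Nc : ℝ),
        (∀ j, beta0OfMerged (betaMerged F (mergedTermFamilyMatT F 2 (TcanOfRecord F 2) (chiFixed29 F 2 θ.ν θ.ε₂₉) θ.εbg) θ.ρ8 θ.bV) θ.v₀ j =
            B12Beta.secondMoment (TbalOf Lc Js j) 0 1) →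
        D1Residue.Residue Lc Js Nc 0 1 →
        ∃ γ₀ : ℝ, 0 < γ₀ ∧ γ₀ ≤ θ.γ ∧
          AtSlopeCont
            (oneLoopSplit_betaOfMerged (betaMerged F (mergedTermFamilyMatT F 2 (TcanOfRecord F 2) (chiFixed29 F 2 θ.ν θ.ε₂₉) θ.εbg) θ.ρ8 θ.bV)
              (beta0OfMerged (betaMerged F (mergedTermFamilyMatT F 2 (TcanOfRecord F 2) (chiFixed29 F 2 θ.ν θ.ε₂₉) θ.εbg) θ.ρ8 θ.bV) θ.v₀) θ.γ)
            γ₀ (B12Normalization.stepBal Nc Lc))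
    (F : T4Family) (θ : Stage13HParams F 2) (hP : θ.Provisos₁₃SepCoPH F 2) (hθ : θ.Admissible F 2) :
    letI := θ.instVβ₁; letI := θ.instVβ₂; letI := θ.instιβ
    ∀ (Lc : ℕ) (_ : NeZero Lc) (Js : ℕ → JetData 3 Lc) (Nc : ℝ),
      (∀ j, beta0OfMerged (betaMerged F (mergedTermFamilyMatT F 2 (TcanOfRecord F 2) (chiFixed29 F 2 θ.ν θ.ε₂₉) θ.εbg) θ.ρ8 θ.bV) θ.v₀ j =
          B12Beta.secondMoment (TbalOf Lc Js j) 0 1) →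
      D1Residue.Residue Lc Js Nc 0 1 → B12Normalization.stepBal Nc Lc = 0 →
      ∃ γ₀ : ℝ, 0 < γ₀ ∧ γ₀ ≤ θ.γ ∧
        ∀ (k : ℕ) (p : Fin (k + 1) → ℝ), p ∈ B12Beta.HistBox γ₀ k →
          betaMerged F (mergedTermFamilyMatT F 2 (TcanOfRecord F 2) (chiFixed29 F 2 θ.ν θ.ε₂₉) θ.εbg) θ.ρ8 θ.bV k p =
            beta0OfMerged (betaMerged F (mergedTermFamilyMatT F 2 (TcanOfRecord F 2) (chiFixed29 F 2 θ.ν θ.ε₂₉) θ.εbg) θ.ρ8 θ.bV) θ.v₀ k := by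
  intro Lc inst Js Nc hβ hres hflat
  obtain ⟨γ₀, hγ₀, hle, hat⟩ := h F θ hP hθ Lc inst Js Nc hβ hres
  rw [hflat] at hat
  exact ⟨γ₀, hγ₀, hle, (atSlopeCont_zero_split_iff _ _ hle).1 hat⟩

/-- **… FROM BOUNDED ONE-LOOP PARTIAL SUMS ALONE** (jets-free form of the flat branch): `D4AtSlopeOfD1Record13` ⟹ at every admissible θ with v1.7 provisos
whose one-loop numbers have BOUNDED partial sums (`OneLoopDrift 0 A β⁰_θ`), the record's merged β-function is history-free on some box family near `g = 0`
— dag-n26's `exists_datum_of_oneLoopDrift_nonneg` realises a flat datum (`Lc = 2`, `Nc = 0`) pinned on `β⁰_θ`, every datum pinned on the same numbers has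
the same slope (`Gaps.D1Residue.oneLoopDrift_slope_unique`), and the previous theorem applies.  READING: the `d = 0` branch of the registered pair is
«bounded one-loop partial sums ⟹ a history-free β» — for Bałaban's record expectedly VACUOUS by (AF-0) (`β⁰ ≥ 2b > 0`, NODE O's fact), never a (D4)-class
statement; a cut whose (D4) stub is a pure estimate carries `0 < stepBal Nc Lc`.  Nothing proved of the stub (instance 0∕1). [cite: Balaban1987RG1, Thm 2 p.259 (first sentence), (1.22) p.264, (2.12)–(2.14) p.268] -/
theorem historyFree_of_d4Stub_boundedDrift
    (h : ∀ (F : T4Family) (θ : Stage13HParams F 2) (hP : θ.Provisos₁₃SepCoPH F 2), θ.Admissible F 2 →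
      letI := θ.instVβ₁; letI := θ.instVβ₂; letI := θ.instιβ
      ∀ (Lc : ℕ) (_ : NeZero Lc) (Js : ℕ → JetData 3 Lc) (Nc : ℝ),
        (∀ j, beta0OfMerged (betaMerged F (mergedTermFamilyMatT F 2 (TcanOfRecord F 2) (chiFixed29 F 2 θ.ν θ.ε₂₉) θ.εbg) θ.ρ8 θ.bV) θ.v₀ j =
            B12Beta.secondMoment (TbalOf Lc Js j) 0 1) →
        D1Residue.Residue Lc Js Nc 0 1 →
        ∃ γ₀ : ℝ, 0 < γ₀ ∧ γ₀ ≤ θ.γ ∧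
          AtSlopeCont
            (oneLoopSplit_betaOfMerged (betaMerged F (mergedTermFamilyMatT F 2 (TcanOfRecord F 2) (chiFixed29 F 2 θ.ν θ.ε₂₉) θ.εbg) θ.ρ8 θ.bV)
              (beta0OfMerged (betaMerged F (mergedTermFamilyMatT F 2 (TcanOfRecord F 2) (chiFixed29 F 2 θ.ν θ.ε₂₉) θ.εbg) θ.ρ8 θ.bV) θ.v₀) θ.γ)
            γ₀ (B12Normalization.stepBal Nc Lc))
    (F : T4Family) (θ : Stage13HParams F 2) (hP : θ.Provisos₁₃SepCoPH F 2) (hθ : θ.Admissible F 2) {A : ℝ}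
    (hA : letI := θ.instVβ₁; letI := θ.instVβ₂; letI := θ.instιβ
      OneLoopDrift 0 A (beta0OfMerged (betaMerged F (mergedTermFamilyMatT F 2 (TcanOfRecord F 2) (chiFixed29 F 2 θ.ν θ.ε₂₉) θ.εbg) θ.ρ8 θ.bV) θ.v₀)) :
    letI := θ.instVβ₁; letI := θ.instVβ₂; letI := θ.instιβ
    ∃ γ₀ : ℝ, 0 < γ₀ ∧ γ₀ ≤ θ.γ ∧
      ∀ (k : ℕ) (p : Fin (k + 1) → ℝ), p ∈ B12Beta.HistBox γ₀ k →
        betaMerged F (mergedTermFamilyMatT F 2 (TcanOfRecord F 2) (chiFixed29 F 2 θ.ν θ.ε₂₉) θ.εbg) θ.ρ8 θ.bV k p =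
          beta0OfMerged (betaMerged F (mergedTermFamilyMatT F 2 (TcanOfRecord F 2) (chiFixed29 F 2 θ.ν θ.ε₂₉) θ.εbg) θ.ρ8 θ.bV) θ.v₀ k := by
  letI := θ.instVβ₁; letI := θ.instVβ₂; letI := θ.instιβ
  obtain ⟨Lc, inst, Js, Nc, hβ, hres⟩ := exists_datum_of_oneLoopDrift_nonneg le_rfl hA 0 1
  obtain ⟨A', hA'⟩ := D1Residue.d1Drift_of_residue Js hres
  have e : (fun j => B12Beta.secondMoment (TbalOf Lc Js j) 0 1) =
      beta0OfMerged (betaMerged F (mergedTermFamilyMatT F 2 (TcanOfRecord F 2) (chiFixed29 F 2 θ.ν θ.ε₂₉) θ.εbg) θ.ρ8 θ.bV) θ.v₀ :=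
    funext fun j => (hβ j).symm
  rw [e] at hA'
  have hflat : B12Normalization.stepBal Nc Lc = 0 := D1Residue.oneLoopDrift_slope_unique hA' hA
  exact historyFree_of_d4Stub_flatDatum h F θ hP hθ Lc inst Js Nc hβ hres hflat

end Stub

end Summit.QuantumFields.YangMills.Theorems.BalabanUVNodesK2StubD4FlatSlope

end
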